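import Summits.MatrixMultiplication.MatrixMultiplication.Theorems.ObstructionCalculusSchurWeylConverse
import Literature.Computability.AlgebraicComplexity.QuantumFunctionalsUpperHighestWeight
import Literature.Computability.AlgebraicComplexity.QuantumFunctionalsUpperMonotone

set_option linter.dupNamespace false
set_option autoImplicit false

/-!
# Obstruction descent — polarisation of pairing kernels and highest-weight slices of a semi-invariant kernel
# (decomp-mm · lens 3 · gen 47, part 1 of the kernel-level UPPER DIRECTION of the blow-up duality; def-free)

`route-MatrixMultiplication-ObstructionDescent`, SUPPORT for the crux `NoOccurrenceObstruction` (`P_O`, stmt 29040);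
NODE-g47 §3, critic ruling lens-3 g47 (i)(a).  Currency: the word model — 3-leg arrays `G : Word N n → Word N n →
Word N n → ℂ`, the pairing `⟪F, G⟫ = Σ_{u,v,w} F(u,v,w) G(u,v,w)` and tensor powers `t^{⊗n} = kroneckerPow t n`.

CONTENT.  §1 ADJOINTNESS: `⟪((A⊗1⊗1)t)^{⊗n}, G⟫ = ⟪t^{⊗n}, G'⟫` with `G'(u,v,w) = Σ_{u'} (∏_k A_{u'_k u_k}) G(u',v,w)`
(`kroneckerPow_actTensor₁`), and the leg-2 analogue.  §2 POLARISATION (`sum_perm_eq_zero_of_forall_pairing_kroneckerPow_eq_zero`):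
if `⟪t^{⊗n}, G⟫ = 0` for EVERY tensor `t`, then the diagonal symmetrisation `Σ_ρ G(u∘ρ, v∘ρ, w∘ρ)` vanishes identically —
the symmetrised array is the coefficient array `arrOf` of the polynomial `t ↦ n!·⟪t^{⊗n}, G⟫ = 0` (`arrOf_sum_C_mul_prod_X`,
`MvPolynomial.funext`; a kernel is determined by its functional only up to the diagonal `S_n`).  §3 CONSEQUENCE for a
kernel `K` (`n = Nδ`) whose functional is a `det^δ`-SEMI-INVARIANT in leg 1, `⟪((A⊗1⊗1)t)^{⊗n}, K⟫ = det A^δ ⟪t^{⊗n}, K⟫`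
for all matrices `A` (singular ones included) and all `t`: the symmetrisation `Kˢ(u,v,w) = Σ_ρ K(u∘ρ,v∘ρ,w∘ρ)` is
EQUIVARIANT, `Σ_{u'} (∏_k A_{u'_k u_k}) Kˢ(u',v,w) = det A^δ Kˢ(u,v,w)` (`symm_leg₁_eq_det_pow_mul`; leg 2 alike), hence every
leg-1 slice `u ↦ Kˢ(u,v,w)` is a HIGHEST-WEIGHT VECTOR of the rectangular weight `(δ^N)` in the word model
(`mem_highestWeightSpace_rectangle_of_equivariant`, via `weightChar_ofPartition_rectangle`).  Part 2
(`…Theorems.ObstructionDescentKernelUpper`) turns this into the occurrence of `((δ^N),(δ^N),ν)`.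
No definition is introduced; sorry-free; nothing here proves `ω = 2` or closes an item.
[cite: BurgisserIkenmeyer2011, §3.1, §10.1] [cite: FultonHarrisGTM129, §15.5] [cite: ChristandlVranaZuiddam2023, §3.1]
-/

noncomputable section

open scoped BigOperators Matrix

namespace Summit.MatrixMultiplication.MatrixMultiplication.Theorems.ObstructionDescentKernelPolarisation

open Literature.Computability.AlgebraicComplexity
open Literature.NumberTheory.DiophantineGeometry
open Literature.RepresentationTheory.GeneralLinear (isotypicProj_apply_of_mem_highestWeightSpace)
open Literature.RepresentationTheory.FiniteGroups (isotypicProj)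
open Summit.MatrixMultiplication.MatrixMultiplication.Theorems.ObstructionCalculus (Idx sum_seq_eq_sum_words)

variable {N : ℕ}

/-! ### §0 Reordering a fourfold sum -/

/-- `Σ_a Σ_b Σ_c Σ_d F = Σ_d Σ_b Σ_c Σ_a F`. [bookkeeping] -/
theorem sum_comm₁₄ {α β γ η : Type*} [Fintype α] [Fintype β] [Fintype γ] [Fintype η] (F : α → β → γ → η → ℂ) :
    ∑ a, ∑ b, ∑ c, ∑ d, F a b c d = ∑ d, ∑ b, ∑ c, ∑ a, F a b c d := by
  have h1 : ∀ a b, ∑ c, ∑ d, F a b c d = ∑ d, ∑ c, F a b c d := fun a b => Finset.sum_comm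
  have h2 : ∀ a, ∑ b, ∑ d, ∑ c, F a b c d = ∑ d, ∑ b, ∑ c, F a b c d := fun a => Finset.sum_comm
  have h3 : ∑ a, ∑ d, ∑ b, ∑ c, F a b c d = ∑ d, ∑ a, ∑ b, ∑ c, F a b c d := Finset.sum_comm
  have h4 : ∀ d, ∑ a, ∑ b, ∑ c, F a b c d = ∑ b, ∑ a, ∑ c, F a b c d := fun d => Finset.sum_comm
  have h5 : ∀ d b, ∑ a, ∑ c, F a b c d = ∑ c, ∑ a, F a b c d := fun d b => Finset.sum_comm
  simp_rw [h1, h2]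
  rw [h3]
  simp_rw [h4, h5]

/-- `Σ_a Σ_b Σ_c F = Σ_c Σ_b Σ_a F`. [bookkeeping] -/
theorem sum_comm₁₃ {α β γ : Type*} [Fintype α] [Fintype β] [Fintype γ] (F : α → β → γ → ℂ) :
    ∑ a, ∑ b, ∑ c, F a b c = ∑ c, ∑ b, ∑ a, F a b c := by
  have h1 : ∀ a, ∑ b, ∑ c, F a b c = ∑ c, ∑ b, F a b c := fun a => Finset.sum_comm
  have h2 : ∑ a, ∑ c, ∑ b, F a b c = ∑ c, ∑ a, ∑ b, F a b c := Finset.sum_comm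
  have h3 : ∀ c, ∑ a, ∑ b, F a b c = ∑ b, ∑ a, F a b c := fun c => Finset.sum_comm
  simp_rw [h1]
  rw [h2]
  simp_rw [h3]

/-! ### §1 Adjointness of the leg actions for the pairing with a tensor power -/

/-- `⟪((A⊗1⊗1)t)^{⊗n}, G⟫ = ⟪t^{⊗n}, G'⟫` with `G'(u,v,w) = Σ_{u'} (∏_k A_{u'_k u_k}) G(u',v,w)`. [folklore] -/
theorem pairing_kroneckerPow_actTensor₁ {n : ℕ} (A : Matrix (Fin N) (Fin N) ℂ) (t : Fin N → Fin N → Fin N → ℂ)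
    (G : Word N n → Word N n → Word N n → ℂ) :
    ∑ u : Word N n, ∑ v : Word N n, ∑ w : Word N n,
        kroneckerPow (actTensor A (1 : Matrix (Fin N) (Fin N) ℂ) (1 : Matrix (Fin N) (Fin N) ℂ) t) n u v w * G u v w =
      ∑ u : Word N n, ∑ v : Word N n, ∑ w : Word N n,
        kroneckerPow t n u v w * ∑ u' : Word N n, (∏ k, A (u' k) (u k)) * G u' v w := by
  classical
  rw [kroneckerPow_actTensor₁]
  simp_rw [powAct₁_apply, Finset.sum_mul, Finset.mul_sum]
  refine Eq.trans (sum_comm₁₄ _) ?_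
  refine Finset.sum_congr rfl fun u _ => Finset.sum_congr rfl fun v _ => Finset.sum_congr rfl fun w _ =>
    Finset.sum_congr rfl fun u' _ => ?_
  ring

/-- `⟪((1⊗B⊗1)t)^{⊗n}, G⟫ = ⟪t^{⊗n}, G''⟫` with `G''(u,v,w) = Σ_{v'} (∏_k B_{v'_k v_k}) G(u,v',w)`. [folklore] -/
theorem pairing_kroneckerPow_actTensor₂ {n : ℕ} (B : Matrix (Fin N) (Fin N) ℂ) (t : Fin N → Fin N → Fin N → ℂ)
    (G : Word N n → Word N n → Word N n → ℂ) :
    ∑ u : Word N n, ∑ v : Word N n, ∑ w : Word N n,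
        kroneckerPow (actTensor (1 : Matrix (Fin N) (Fin N) ℂ) B (1 : Matrix (Fin N) (Fin N) ℂ) t) n u v w * G u v w =
      ∑ u : Word N n, ∑ v : Word N n, ∑ w : Word N n,
        kroneckerPow t n u v w * ∑ v' : Word N n, (∏ k, B (v' k) (v k)) * G u v' w := by
  classical
  rw [kroneckerPow_actTensor₂]
  simp_rw [powAct₂_apply, Finset.sum_mul, Finset.mul_sum]
  refine Finset.sum_congr rfl fun u _ => ?_
  refine Eq.trans (sum_comm₁₃ _) ?_
  refine Finset.sum_congr rfl fun v _ => Finset.sum_congr rfl fun w _ => Finset.sum_congr rfl fun v' _ => ?_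
  ring

/-! ### §2 Polarisation: a kernel pairing to zero with every tensor power has zero diagonal symmetrisation -/

/-- **Polarisation.**  If `⟪t^{⊗n}, G⟫ = 0` for every tensor `t`, then `Σ_ρ G(u∘ρ, v∘ρ, w∘ρ) = 0` for all words `u, v, w`:
the symmetrised array is the array (`arrOf`) of the polynomial `t ↦ n!·⟪t^{⊗n}, G⟫ = 0`.
[cite: BurgisserIkenmeyer2011, §10.1 (polarisation)] -/
theorem sum_perm_eq_zero_of_forall_pairing_kroneckerPow_eq_zero {n : ℕ} (G : Word N n → Word N n → Word N n → ℂ)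
    (hG : ∀ t : Fin N → Fin N → Fin N → ℂ, ∑ u : Word N n, ∑ v : Word N n, ∑ w : Word N n,
      kroneckerPow t n u v w * G u v w = 0) (u v w : Word N n) :
    ∑ ρ : Equiv.Perm (Fin n), G (u ∘ ⇑ρ) (v ∘ ⇑ρ) (w ∘ ⇑ρ) = 0 := by
  classical
  -- the symmetrised array on sequences `I : Fin n → Idx N`
  set A' : (Fin n → Idx N) → ℂ := fun I =>
    ∑ ρ : Equiv.Perm (Fin n), G (fun r => (I (ρ r)).1) (fun r => (I (ρ r)).2.1) (fun r => (I (ρ r)).2.2) with hA'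
  have hsymm : ∀ (I : Fin n → Idx N) (π : Equiv.Perm (Fin n)), A' (I ∘ ⇑π) = A' I := by
    intro I π
    simp only [hA', Function.comp_apply]
    exact Equiv.sum_comp (Equiv.mulLeft π) (fun ρ : Equiv.Perm (Fin n) =>
      G (fun r => (I (ρ r)).1) (fun r => (I (ρ r)).2.1) (fun r => (I (ρ r)).2.2))
  -- the polynomial `q = Σ_I A'_I x_I` vanishes identically
  have hq : (∑ I : Fin n → Idx N, MvPolynomial.C (A' I) * ∏ j, MvPolynomial.X (I j) : MvPolynomial (Idx N) ℂ) = 0 := by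
    apply MvPolynomial.funext
    intro x
    rw [map_zero]
    simp only [map_sum, map_mul, MvPolynomial.eval_C, map_prod, MvPolynomial.eval_X]
    have hx := hG (fun a b c => x (a, b, c))
    -- `Σ_I A'_I ∏ x_{I j} = Σ_ρ Σ_I G(I∘ρ) ∏ x_{I j} = n! · ⟪x^{⊗n}, G⟫`
    have h1 : ∀ ρ : Equiv.Perm (Fin n), ∑ I : Fin n → Idx N,
        G (fun r => (I (ρ r)).1) (fun r => (I (ρ r)).2.1) (fun r => (I (ρ r)).2.2) * ∏ j, x (I j) =
          ∑ u : Word N n, ∑ v : Word N n, ∑ w : Word N n, kroneckerPow (fun a b c => x (a, b, c)) n u v w * G u v w := by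
      intro ρ
      have h2 : ∑ I : Fin n → Idx N,
          G (fun r => (I (ρ r)).1) (fun r => (I (ρ r)).2.1) (fun r => (I (ρ r)).2.2) * ∏ j, x (I j) =
            ∑ I : Fin n → Idx N, G (fun r => (I r).1) (fun r => (I r).2.1) (fun r => (I r).2.2) * ∏ j, x (I j) := by
        refine Fintype.sum_equiv (Equiv.arrowCongr ρ⁻¹ (Equiv.refl (Idx N))) _ _ fun I => ?_
        have hI : (Equiv.arrowCongr ρ⁻¹ (Equiv.refl (Idx N))) I = I ∘ ⇑ρ := by
          funext k; simp [Equiv.arrowCongr_apply, Equiv.Perm.inv_def]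
        rw [hI, ← Equiv.prod_comp ρ (fun j => x (I j))]
        rfl
      rw [h2, sum_seq_eq_sum_words]
      refine Finset.sum_congr rfl fun u _ => Finset.sum_congr rfl fun v _ => Finset.sum_congr rfl fun w _ => ?_
      rw [kroneckerPow_apply, mul_comm]
    calc ∑ I : Fin n → Idx N, A' I * ∏ j, x (I j)
        = ∑ I : Fin n → Idx N, ∑ ρ : Equiv.Perm (Fin n),
            G (fun r => (I (ρ r)).1) (fun r => (I (ρ r)).2.1) (fun r => (I (ρ r)).2.2) * ∏ j, x (I j) := by
          refine Finset.sum_congr rfl fun I _ => ?_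
          rw [hA', Finset.sum_mul]
      _ = ∑ ρ : Equiv.Perm (Fin n), ∑ I : Fin n → Idx N,
            G (fun r => (I (ρ r)).1) (fun r => (I (ρ r)).2.1) (fun r => (I (ρ r)).2.2) * ∏ j, x (I j) := Finset.sum_comm
      _ = 0 := by simp_rw [h1, hx, Finset.sum_const_zero]
  -- read off the array at `J = (u, v, w)`
  have harr := arrOf_sum_C_mul_prod_X (k := ℂ) hsymm (fun r => (u r, v r, w r))
  rw [hq] at harr
  have h0 : arrOf n (0 : MvPolynomial (Idx N) ℂ) (fun r => (u r, v r, w r)) = 0 := by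
    simp [arrOf]
  rw [h0] at harr
  have hJ : A' (fun r => (u r, v r, w r)) = ∑ ρ : Equiv.Perm (Fin n), G (u ∘ ⇑ρ) (v ∘ ⇑ρ) (w ∘ ⇑ρ) := by
    rw [hA']
    rfl
  rw [← hJ, ← harr]

/-! ### §3 The symmetrisation of a semi-invariant kernel has highest-weight slices -/

/-- From leg-1 semi-invariance of the functional of `K` to the EQUIVARIANCE of its symmetrisation `Kˢ(u,v,w) =
Σ_ρ K(u∘ρ,v∘ρ,w∘ρ)`: `Σ_{u'} (∏_k A_{u'_k u_k}) Kˢ(u',v,w) = det A^δ · Kˢ(u,v,w)` for every matrix `A`. [this node] -/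
theorem symm_leg₁_eq_det_pow_mul {δ : ℕ} (K : Word N (N * δ) → Word N (N * δ) → Word N (N * δ) → ℂ)
    (hK₁ : ∀ (A : Matrix (Fin N) (Fin N) ℂ) (t : Fin N → Fin N → Fin N → ℂ),
      ∑ u : Word N (N * δ), ∑ v : Word N (N * δ), ∑ w : Word N (N * δ),
          kroneckerPow (actTensor A (1 : Matrix (Fin N) (Fin N) ℂ) (1 : Matrix (Fin N) (Fin N) ℂ) t) (N * δ) u v w *
            K u v w =
        A.det ^ δ * ∑ u : Word N (N * δ), ∑ v : Word N (N * δ), ∑ w : Word N (N * δ),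
          kroneckerPow t (N * δ) u v w * K u v w)
    (A : Matrix (Fin N) (Fin N) ℂ) (u v w : Word N (N * δ)) :
    ∑ u' : Word N (N * δ), (∏ k, A (u' k) (u k)) *
        ∑ ρ : Equiv.Perm (Fin (N * δ)), K (u' ∘ ⇑ρ) (v ∘ ⇑ρ) (w ∘ ⇑ρ) =
      A.det ^ δ * ∑ ρ : Equiv.Perm (Fin (N * δ)), K (u ∘ ⇑ρ) (v ∘ ⇑ρ) (w ∘ ⇑ρ) := by
  classical
  -- the kernel `G = (Aᵀ ·₁ K) − det A^δ K` pairs to zero with every tensor power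
  have hG : ∀ t : Fin N → Fin N → Fin N → ℂ, ∑ u : Word N (N * δ), ∑ v : Word N (N * δ), ∑ w : Word N (N * δ),
      kroneckerPow t (N * δ) u v w *
        ((∑ u' : Word N (N * δ), (∏ k, A (u' k) (u k)) * K u' v w) - A.det ^ δ * K u v w) = 0 := by
    intro t
    simp_rw [mul_sub, Finset.sum_sub_distrib]
    rw [← pairing_kroneckerPow_actTensor₁, hK₁ A t, sub_eq_zero, Finset.mul_sum]
    refine Finset.sum_congr rfl fun u _ => ?_
    rw [Finset.mul_sum]
    refine Finset.sum_congr rfl fun v _ => ?_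
    rw [Finset.mul_sum]
    refine Finset.sum_congr rfl fun w _ => ?_
    ring
  have hs := sum_perm_eq_zero_of_forall_pairing_kroneckerPow_eq_zero _ hG u v w
  simp only [Finset.sum_sub_distrib, sub_eq_zero, ← Finset.mul_sum] at hs
  rw [← hs]
  -- reindex `u' ↦ u' ∘ ρ` inside, then swap the sums
  have h1 : ∀ ρ : Equiv.Perm (Fin (N * δ)), ∑ u' : Word N (N * δ), (∏ k, A (u' k) ((u ∘ ⇑ρ) k)) * K u' (v ∘ ⇑ρ) (w ∘ ⇑ρ) =
      ∑ u' : Word N (N * δ), (∏ k, A (u' k) (u k)) * K (u' ∘ ⇑ρ) (v ∘ ⇑ρ) (w ∘ ⇑ρ) := by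
    intro ρ
    symm
    refine Fintype.sum_equiv (Equiv.arrowCongr ρ⁻¹ (Equiv.refl (Fin N))) _ _ fun u' => ?_
    have hu : (Equiv.arrowCongr ρ⁻¹ (Equiv.refl (Fin N))) u' = u' ∘ ⇑ρ := by
      funext k; simp [Equiv.arrowCongr_apply, Equiv.Perm.inv_def]
    rw [hu, ← Equiv.prod_comp ρ (fun k => A (u' k) (u k))]
    rfl
  simp_rw [h1]
  simp only [Finset.mul_sum]
  exact Finset.sum_comm

/-- The same in leg 2: `Σ_{v'} (∏_k B_{v'_k v_k}) Kˢ(u,v',w) = det B^δ · Kˢ(u,v,w)`. [this node] -/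
theorem symm_leg₂_eq_det_pow_mul {δ : ℕ} (K : Word N (N * δ) → Word N (N * δ) → Word N (N * δ) → ℂ)
    (hK₂ : ∀ (B : Matrix (Fin N) (Fin N) ℂ) (t : Fin N → Fin N → Fin N → ℂ),
      ∑ u : Word N (N * δ), ∑ v : Word N (N * δ), ∑ w : Word N (N * δ),
          kroneckerPow (actTensor (1 : Matrix (Fin N) (Fin N) ℂ) B (1 : Matrix (Fin N) (Fin N) ℂ) t) (N * δ) u v w *
            K u v w =
        B.det ^ δ * ∑ u : Word N (N * δ), ∑ v : Word N (N * δ), ∑ w : Word N (N * δ),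
          kroneckerPow t (N * δ) u v w * K u v w)
    (B : Matrix (Fin N) (Fin N) ℂ) (u v w : Word N (N * δ)) :
    ∑ v' : Word N (N * δ), (∏ k, B (v' k) (v k)) *
        ∑ ρ : Equiv.Perm (Fin (N * δ)), K (u ∘ ⇑ρ) (v' ∘ ⇑ρ) (w ∘ ⇑ρ) =
      B.det ^ δ * ∑ ρ : Equiv.Perm (Fin (N * δ)), K (u ∘ ⇑ρ) (v ∘ ⇑ρ) (w ∘ ⇑ρ) := by
  classical
  have hG : ∀ t : Fin N → Fin N → Fin N → ℂ, ∑ u : Word N (N * δ), ∑ v : Word N (N * δ), ∑ w : Word N (N * δ),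
      kroneckerPow t (N * δ) u v w *
        ((∑ v' : Word N (N * δ), (∏ k, B (v' k) (v k)) * K u v' w) - B.det ^ δ * K u v w) = 0 := by
    intro t
    simp_rw [mul_sub, Finset.sum_sub_distrib]
    rw [← pairing_kroneckerPow_actTensor₂, hK₂ B t, sub_eq_zero, Finset.mul_sum]
    refine Finset.sum_congr rfl fun u _ => ?_
    rw [Finset.mul_sum]
    refine Finset.sum_congr rfl fun v _ => ?_
    rw [Finset.mul_sum]
    refine Finset.sum_congr rfl fun w _ => ?_
    ring
  have hs := sum_perm_eq_zero_of_forall_pairing_kroneckerPow_eq_zero _ hG u v w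
  simp only [Finset.sum_sub_distrib, sub_eq_zero, ← Finset.mul_sum] at hs
  rw [← hs]
  have h1 : ∀ ρ : Equiv.Perm (Fin (N * δ)), ∑ v' : Word N (N * δ), (∏ k, B (v' k) ((v ∘ ⇑ρ) k)) * K (u ∘ ⇑ρ) v' (w ∘ ⇑ρ) =
      ∑ v' : Word N (N * δ), (∏ k, B (v' k) (v k)) * K (u ∘ ⇑ρ) (v' ∘ ⇑ρ) (w ∘ ⇑ρ) := by
    intro ρ
    symm
    refine Fintype.sum_equiv (Equiv.arrowCongr ρ⁻¹ (Equiv.refl (Fin N))) _ _ fun v' => ?_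
    have hv : (Equiv.arrowCongr ρ⁻¹ (Equiv.refl (Fin N))) v' = v' ∘ ⇑ρ := by
      funext k; simp [Equiv.arrowCongr_apply, Equiv.Perm.inv_def]
    rw [hv, ← Equiv.prod_comp ρ (fun k => B (v' k) (v k))]
    rfl
  simp_rw [h1]
  simp only [Finset.mul_sum]
  exact Finset.sum_comm

/-- **Equivariant slices are highest-weight vectors of the rectangular weight `(δ^N)`**: if
`Σ_{u'} (∏_k A_{u'_k u_k}) φ(u') = det A^δ φ(u)` for all matrices `A`, then `φ ∈ HW_{(δ^N)}` in the word model
(`g ↦ gᵀ`; `χ_{(δ^N)}(b) = det b^δ` on the Borel, `weightChar_ofPartition_rectangle`). [cite: FultonHarrisGTM129, §15.5] -/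
theorem mem_highestWeightSpace_rectangle_of_equivariant {n δ : ℕ} (φ : Word N n → ℂ)
    (hφ : ∀ (A : Matrix (Fin N) (Fin N) ℂ) (u : Word N n), ∑ u' : Word N n, (∏ k, A (u' k) (u k)) * φ u' = A.det ^ δ * φ u) :
    φ ∈ highestWeightSpace (wordRep ℂ N n) (Weight.ofPartition N (Nat.Partition.rectangle N δ)) := by
  rw [mem_highestWeightSpace_iff]
  intro g hg
  funext u
  rw [wordRep_apply, Pi.smul_apply, weightChar_ofPartition_rectangle hg, smul_eq_mul]
  have h := hφ ((g : Matrix (Fin N) (Fin N) ℂ)ᵀ) u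
  simp only [Matrix.transpose_apply, Matrix.det_transpose] at h
  exact h

end Summit.MatrixMultiplication.MatrixMultiplication.Theorems.ObstructionDescentKernelPolarisation
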